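import Mathlib
import Summits.AtomisticToContinuum.HydrodynamicLimit.Theses.JaynesSqueeze
import Summits.AtomisticToContinuum.HydrodynamicLimit.Theorems.JaynesSqueezeEntropicWeakStrongHSCoerciveB
import HarnessLib

/-!
# `EntropicWeakStrongHS` (stmt-AtomisticToContinuum-13461): the threshold `η₀` and continuity of
# the entropy and the fluxes on the positivity region

* `eos_setup` — from `HsEosLowDensity`: `η₀ > 0`, `F` analytic on `(-η₀, η₀)` with
  `hsExcessFreeEnergy = F` on `[0, η₀)` and the convexity inequality `2F'(η) + ηF''(η) ≥ 0` on
  `[0, η₀)` (from `F'(0) = 2π/3 > 0` by continuity; `η₀` is the minimum of the analyticity radius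
  and the convexity threshold);
* `continuousOn_entropy_region`, `continuousOn_flux_region` — the entropy `h` and the fluxes `fᵢ`
  of the route statement are continuous on the positivity/low-packing region (hence on `K`).
-/

noncomputable section

open Set Filter MeasureTheory Function
open scoped Topology ContDiff

namespace Summit.AtomisticToContinuum.HydrodynamicLimit.Theorems.EntropicWeakStrong

open Literature.MathematicalPhysics.KineticTheory Literature.Analysis.FunctionSpaces

/-! ### The threshold `η₀` -/

/-- **The equation-of-state package at small packing.** From `HsEosLowDensity`: `η₀ > 0` and `F`
analytic on `(-η₀, η₀)` with `hsExcessFreeEnergy = F` on `[0, η₀)` and `2F'(η) + ηF''(η) ≥ 0` on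
`[0, η₀)` (convexity of `y ↦ yF(yσ³)`; from `F'(0) = 2π/3 > 0` by continuity). -/
theorem eos_setup (hEos : Summit.AtomisticToContinuum.HydrodynamicLimit.Theses.JaynesSqueeze.HsEosLowDensity) :
    ∃ η₀ : ℝ, 0 < η₀ ∧ ∃ F : ℝ → ℝ, AnalyticOnNhd ℝ F (Ioo (-η₀) η₀) ∧
      EqOn hsExcessFreeEnergy F (Ico 0 η₀) ∧
      ∀ η ∈ Ico 0 η₀, 0 ≤ 2 * deriv F η + η * deriv (deriv F) η := by
  obtain ⟨η₁, hη₁, F, hFa, hF, -, hF1, -⟩ := hEos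
  have h0 : (0 : ℝ) ∈ Ioo (-η₁) η₁ := ⟨by linarith, hη₁⟩
  -- `g(η) = 2F'(η) + ηF''(η)` is continuous at `0` with `g(0) = 4π/3 > 0`
  have hc : ContinuousAt (fun η => 2 * deriv F η + η * deriv (deriv F) η) 0 := by
    have h1 : ContinuousAt (deriv F) 0 := (hFa.deriv 0 h0).continuousAt
    have h2 : ContinuousAt (deriv (deriv F)) 0 := (hFa.deriv.deriv 0 h0).continuousAt
    exact (continuousAt_const.mul h1).add (continuousAt_id.mul h2)
  have hg0 : 0 < 2 * deriv F 0 + 0 * deriv (deriv F) 0 := by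
    rw [hF1, zero_mul, add_zero]; positivity
  have hev : ∀ᶠ η in 𝓝 (0 : ℝ), 0 < 2 * deriv F η + η * deriv (deriv F) η :=
    hc.eventually (lt_mem_nhds hg0)
  obtain ⟨ε, hε, hball⟩ := Metric.eventually_nhds_iff.1 hev
  refine ⟨min η₁ ε, lt_min hη₁ hε, F, hFa.mono ?_, hF.mono ?_, fun η hη => ?_⟩
  · exact Ioo_subset_Ioo (by simp [neg_le_neg_iff]) (min_le_left _ _)
  · exact Ico_subset_Ico_right (min_le_left _ _)
  · have : dist η 0 < ε := by
      rw [Real.dist_eq, sub_zero, abs_of_nonneg hη.1]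
      exact hη.2.trans_le (min_le_right _ _)
    exact (hball this).le

/-! ### Continuity of the entropy and the fluxes on the positivity region -/

section Region

variable {σ η₀ : ℝ} {F : ℝ → ℝ}

/-- The entropy `h` of the statement is continuous on the positivity/low-packing region. -/
theorem continuousOn_entropy_region (hσ : 0 < σ) (hFa : AnalyticOnNhd ℝ F (Ioo (-η₀) η₀))
    (hF : EqOn hsExcessFreeEnergy F (Ico 0 η₀))
    (θo : (ℝ × V3 × ℝ) → ℝ)
    (hθo : θo = fun U => 2 / 3 * (U.2.2 / U.1 - ‖U.2.1‖ ^ 2 / (2 * U.1 ^ 2)))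
    (h : (ℝ × V3 × ℝ) → ℝ)
    (hh : h = fun U => -(U.1 * (3 / 2 * Real.log (θo U) - Real.log U.1 -
      hsExcessFreeEnergy (U.1 * σ ^ 3))))
    {K : Set (ℝ × V3 × ℝ)}
    (hKΩ : K ⊆ {U : ℝ × V3 × ℝ | 0 < U.1 ∧ U.1 * σ ^ 3 < η₀ ∧ ‖U.2.1‖ ^ 2 < 2 * U.1 * U.2.2}) :
    ContinuousOn h K := by
  have hK1 : ∀ V ∈ K, V.1 ≠ 0 := fun V hV => (hKΩ hV).1.ne'
  have hθoc := continuousOn_thetaOf θo hθo hK1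
  have hθopos : ∀ V ∈ K, θo V ≠ 0 := fun V hV => (thetaOf_pos θo hθo (hKΩ hV).1 (hKΩ hV).2.2).ne'
  have hmaps : MapsTo (fun U : ℝ × V3 × ℝ => U.1 * σ ^ 3) K (Ioo (-η₀) η₀) := by
    intro U hU
    have h1 : 0 < U.1 * σ ^ 3 := mul_pos (hKΩ hU).1 (pow_pos hσ 3)
    have h2 : U.1 * σ ^ 3 < η₀ := (hKΩ hU).2.1
    exact ⟨by linarith, h2⟩
  have hFc : ContinuousOn (fun U : ℝ × V3 × ℝ => F (U.1 * σ ^ 3)) K :=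
    hFa.continuousOn.comp (continuousOn_fst.mul continuousOn_const) hmaps
  have hc : ContinuousOn (fun U : ℝ × V3 × ℝ => -(U.1 * (3 / 2 * Real.log (θo U) - Real.log U.1 -
      F (U.1 * σ ^ 3)))) K :=
    (continuousOn_fst.mul (((continuousOn_const.mul (hθoc.log hθopos)).sub
      (continuousOn_fst.log hK1)).sub hFc)).neg
  rw [hh]
  refine hc.congr fun U hU => ?_
  have hpk : U.1 * σ ^ 3 ∈ Ico 0 η₀ := ⟨(mul_pos (hKΩ hU).1 (pow_pos hσ 3)).le, (hKΩ hU).2.1⟩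
  simp only [hF hpk]

/-- The fluxes of the statement are continuous on the positivity/low-packing region. -/
theorem continuousOn_flux_region (hσ : 0 < σ) (hFa : AnalyticOnNhd ℝ F (Ioo (-η₀) η₀))
    (hF : EqOn hsExcessFreeEnergy F (Ico 0 η₀))
    (θo : (ℝ × V3 × ℝ) → ℝ)
    (hθo : θo = fun U => 2 / 3 * (U.2.2 / U.1 - ‖U.2.1‖ ^ 2 / (2 * U.1 ^ 2)))
    (flux : Fin 3 → (ℝ × V3 × ℝ) → (ℝ × V3 × ℝ))
    (hflux : flux = fun i U => (U.2.1 i, (U.2.1 i / U.1) • U.2.1 +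
      hsPressure σ U.1 (θo U) • EuclideanSpace.single i (1 : ℝ),
      (U.2.2 + hsPressure σ U.1 (θo U)) * U.2.1 i / U.1))
    {K : Set (ℝ × V3 × ℝ)}
    (hKΩ : K ⊆ {U : ℝ × V3 × ℝ | 0 < U.1 ∧ U.1 * σ ^ 3 < η₀ ∧ ‖U.2.1‖ ^ 2 < 2 * U.1 * U.2.2})
    (i : Fin 3) : ContinuousOn (flux i) K := by
  have hK1 : ∀ V ∈ K, V.1 ≠ 0 := fun V hV => (hKΩ hV).1.ne'
  have hθoc := continuousOn_thetaOf θo hθo hK1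
  have hmaps : MapsTo (fun U : ℝ × V3 × ℝ => U.1 * σ ^ 3) K (Ioo 0 η₀) := fun U hU =>
    ⟨mul_pos (hKΩ hU).1 (pow_pos hσ 3), (hKΩ hU).2.1⟩
  have hZc : ContinuousOn (fun U : ℝ × V3 × ℝ => hsCompressibility (U.1 * σ ^ 3)) K :=
    (analyticOnNhd_hsCompressibility hFa hF).continuousOn.comp (continuousOn_fst.mul continuousOn_const) hmaps
  have hpc : ContinuousOn (fun U : ℝ × V3 × ℝ => hsPressure σ U.1 (θo U)) K := by
    simp only [hsPressure]
    exact (continuousOn_fst.mul hθoc).mul hZc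
  have hui : ContinuousOn (fun U : ℝ × V3 × ℝ => U.2.1 i) K :=
    (EuclideanSpace.proj i : V3 →L[ℝ] ℝ).continuous.comp_continuousOn continuousOn_snd.fst
  rw [hflux]
  refine hui.prodMk (ContinuousOn.prodMk ?_ ?_)
  · exact ((hui.div continuousOn_fst hK1).smul continuousOn_snd.fst).add (hpc.smul continuousOn_const)
  · exact ((continuousOn_snd.snd.add hpc).mul hui).div continuousOn_fst hK1

end Region

end Summit.AtomisticToContinuum.HydrodynamicLimit.Theorems.EntropicWeakStrong

end
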